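import Summits.Ventures.CertifiedManyBodySolver.Downfold.PhaseMapDistanceToPass

/-!
# Isotope twins in the router R table: why «a twin pair counts ONCE» is load-bearing (FINDING F21)

Kernel reference 19 of the material-oracle ACCEPTANCE test landed by hubbard-downfold-score-1 (second engine), in
namespace `Summit.Ventures.CertifiedManyBodySolver.Downfold.CellScore.Tally`. Context: downfold-lead VALIDATION-SET ruling
R16(c) (2026-08-27T03:22Z): «ISOTOPE TWINS … the router word is mass-independent ⇒ ONE descriptor record per protium/deuteride
pair, the twin's router column is BY REFERENCE … and for the v5 ROUTER R table a twin pair counts ONCE (score pens flag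
twin_of); the phase-map / T_c tables count both cells». ACCEPTANCE v1.8 §4.2 (R = AGREE/(AGREE+PARTIAL+DISAGREE+uncoded), one
reading per material) has no twin clause and neither phase-map engine reads the curators' `twin_of` key, so at the first
v5 assembly that words Th₄H₁₅ (M168) AND Th₄D₁₅ (M169) the pair would enter the v5 R tally twice — FINDINGS-2026-08-27-g6 F21.

What is proved here is the arithmetic behind «counts once»: a by-reference twin is the SAME reading entered a second time,
and entering a reading twice moves the ratio further than entering it once — far enough to flip a §7 floor in either
direction. With the `Tally` API of `PhaseMapTablePooling` / `PhaseMapDistanceToPass` (floor test `meets θ t` =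
`θ·den ≤ num`, `addAgree c` = c agreeing readings, `addMiss c` = c non-agreeing readings):

* `meets_twin_agree_twice_of_once` / `fails_twin_miss_twice_of_once`: double-counting is MONOTONE in the twin's direction
  (an agreeing pair counted twice keeps every floor the honest count keeps; a missing pair counted twice fails every floor
  the honest count fails) — so the double count can only ever help an agreeing pair and hurt a missing one;
* `double_count_flips_pass` : R = 16/18 plus ONE agreeing twin reads 17/19 < 0.90 (honest) but 18/20 ≥ 0.90 when the pair
  is counted twice — a PASS manufactured by bookkeeping;
* `double_count_flips_fail` : R = 9/9 plus ONE partial twin reads 9/10 ≥ 0.90 (honest) but 9/11 < 0.90 counted twice — a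
  FAIL manufactured by bookkeeping;
* `cross_table_twin_untouched` : tables are never pooled (R35/R50), so a twin whose partner sits in ANOTHER table changes
  nothing in that table — only the same-table pair (M168/M169 in v5) needs the rule; the three cross-table twins
  (M179→M70, M180→M08, M181→M09) are tallied normally in v5.

WHAT THIS IS NOT: a ruling (the acceptance pen decides the reading; the second engine staged it behind a flag) or a
statement about any material — pure bookkeeping arithmetic on ℕ-tallies; «[folklore]» throughout.
-/

namespace Summit.Ventures.CertifiedManyBodySolver.Downfold

namespace CellScore

namespace Tally

/-! ## §1 Double-counting is monotone in the twin's direction -/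

/-- An AGREEING twin pair counted twice keeps every floor θ ≤ 1 that the honest (once) count keeps. [folklore] -/
theorem meets_twin_agree_twice_of_once (θ : ℚ) (hθ1 : θ ≤ 1) (t : Tally)
    (h : meets θ (t.addAgree 1) = true) : meets θ (t.addAgree 2) = true :=
  meets_addAgree_succ θ hθ1 t 1 h

/-- A NON-AGREEING twin pair counted twice fails every floor θ ≥ 0 that the honest (once) count fails. [folklore] -/
theorem fails_twin_miss_twice_of_once (θ : ℚ) (hθ : 0 ≤ θ) (t : Tally)
    (h : meets θ (t.addMiss 1) = false) : meets θ (t.addMiss 2) = false := by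
  by_contra h2
  simp only [Bool.not_eq_false] at h2
  have := meets_addMiss_anti θ hθ t 1 h2
  simp [this] at h

/-- Read contrapositively: if the double count of an agreeing pair FAILS a floor, the honest count fails it too — the
double count never hides a failure of an agreeing pair, it can only hide a failure's ABSENCE (next section). [folklore] -/
theorem fails_once_of_fails_twice_agree (θ : ℚ) (hθ1 : θ ≤ 1) (t : Tally)
    (h : meets θ (t.addAgree 2) = false) : meets θ (t.addAgree 1) = false := by
  by_contra h1
  simp only [Bool.not_eq_false] at h1
  have := meets_twin_agree_twice_of_once θ hθ1 t h1
  simp [this] at h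

/-! ## §2 … and strictly so: the double count flips the §7 R floor (0.90) in both directions -/

/-- A PASS manufactured by bookkeeping: a table at 16/18 plus one AGREEING twin pair — honest count 17/19 (< 0.90, fails),
double count 18/20 (= 0.90, meets). [folklore] -/
theorem double_count_flips_pass :
    meets (9 / 10) ((Tally.mk 16 18).addAgree 1) = false ∧ meets (9 / 10) ((Tally.mk 16 18).addAgree 2) = true := by
  constructor <;> simp only [addAgree, meets] <;> norm_num

/-- A FAIL manufactured by bookkeeping: a table at 9/9 plus one PARTIAL twin pair — honest count 9/10 (meets 0.90),
double count 9/11 (< 0.90, fails). [folklore] -/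
theorem double_count_flips_fail :
    meets (9 / 10) ((Tally.mk 9 9).addMiss 1) = true ∧ meets (9 / 10) ((Tally.mk 9 9).addMiss 2) = false := by
  constructor <;> simp only [addMiss, meets] <;> norm_num

/-- The same two flips at the cuprate/nickelate floor 0.60: 1/2 + agreeing pair: honest 2/3 meets? (0.667 ≥ 0.6 ✓) — here
the HONEST count already meets; but at 0/1: honest 1/2 fails 0.6 while the double count 2/3 meets it. [folklore] -/
theorem double_count_flips_pass_060 :
    meets (3 / 5) ((Tally.mk 0 1).addAgree 1) = false ∧ meets (3 / 5) ((Tally.mk 0 1).addAgree 2) = true := by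
  constructor <;> simp only [addAgree, meets] <;> norm_num

/-- In ratio terms the double count always lands WEAKLY BEYOND the honest count on the twin's side: for an agreeing pair
num/den ≤ (num+1)/(den+1) ≤ (num+2)/(den+2) whenever num ≤ den (a proper R tally) and den > 0. [folklore] -/
theorem ratio_addAgree_chain (k n : ℕ) (hkn : k ≤ n) (hn : 0 < n) :
    (Tally.mk k n).ratio ≤ ((Tally.mk k n).addAgree 1).ratio ∧
      ((Tally.mk k n).addAgree 1).ratio ≤ ((Tally.mk k n).addAgree 2).ratio := by
  simp only [ratio, addAgree]
  have hn' : (0 : ℚ) < n := by exact_mod_cast hn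
  have hkn' : (k : ℚ) ≤ n := by exact_mod_cast hkn
  constructor
  · rw [div_le_div_iff₀ hn' (by push_cast; linarith)]
    push_cast; nlinarith
  · rw [div_le_div_iff₀ (by push_cast; linarith) (by push_cast; linarith)]
    push_cast; nlinarith

/-- … and for a non-agreeing pair num/(den+2) ≤ num/(den+1) ≤ num/den. [folklore] -/
theorem ratio_addMiss_chain (k n : ℕ) (hn : 0 < n) :
    ((Tally.mk k n).addMiss 2).ratio ≤ ((Tally.mk k n).addMiss 1).ratio ∧
      ((Tally.mk k n).addMiss 1).ratio ≤ (Tally.mk k n).ratio := by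
  simp only [ratio, addMiss]
  have hn' : (0 : ℚ) < n := by exact_mod_cast hn
  have hk : (0 : ℚ) ≤ k := by exact_mod_cast Nat.zero_le k
  constructor
  · exact div_le_div_of_nonneg_left hk (by push_cast; linarith) (by push_cast; linarith)
  · exact div_le_div_of_nonneg_left hk hn' (by push_cast; linarith)

/-! ## §3 Cross-table twins need no rule: tables are never pooled -/

/-- The v5 table's R tally is a function of the v5 readings alone: whatever a partner in ANOTHER table reads (here an
arbitrary tally `other` standing for the v1/v2 table holding M08/M09/M70), pooling is what WOULD couple them, and the
tables of record are never pooled (R35/R50) — so only a SAME-TABLE pair (M168/M169) can be double-counted. Formally: the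
v5 verdict `meets θ v5` does not mention `other`. [folklore] -/
theorem cross_table_twin_untouched (θ : ℚ) (v5 other : Tally) :
    meets θ v5 = meets θ (pool v5 zero) ∧ (pool v5 zero ≠ pool v5 other → other ≠ zero) := by
  refine ⟨by simp [pool, zero], fun h => ?_⟩
  rintro rfl; exact h rfl

/-- The pooled cross-check (informational, never of record) is the one place where all four pairs would double: pooling
v1 ∪ v5 puts M08 and M180 in one tally, i.e. `(pool v1 v5).addAgree 0` already contains both readings. Counting once
there means dropping the twin's reading from the pool: pool v1 (v5 minus twin). Bookkeeping identity: [folklore] -/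
theorem pooled_pair_is_addAgree_two (rest : Tally) :
    pool (rest.addAgree 1) (Tally.mk 1 1) = rest.addAgree 2 := by
  simp only [pool, addAgree]

/-! ## §4 (APPEND) The ruling (ACCEPTANCE v1.9 item 10, deputy-2 2026-08-27T07:42:10Z — F21 CLOSED, reading (b)): a material whose truth
carries `twin_of` is R-EXEMPT in its own table, in- AND cross-table alike (superseding §3's g6 reading for cross-table twins) — the exemption
as a Tally operation and the v5 numbers of record -/

/-- Reading (b) seen from the tally: the table's R over NON-twins is the honest tally `t`; counting the worded twins as well is
`t.addAgree a` for `a` agreeing twins (and `·.addMiss m` for `m` non-agreeing ones). Exempting AGREEING twins can only take a PASS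
away, never manufacture one: if the exempt tally meets θ ≤ 1, the counted one met it too (contrapositive of the honesty direction). [folklore] -/
theorem exempt_agree_honest (θ : ℚ) (hθ1 : θ ≤ 1) (t : Tally) (a : ℕ)
    (h : meets θ t = true) : meets θ (t.addAgree a) = true := by
  have h0 : t.addAgree 0 = t := by cases t; simp [addAgree]
  have := meets_addAgree_mono θ hθ1 t 0 a (by rw [h0]; exact h)
  simpa using this

/-- … and exempting NON-agreeing twins can only help: if the counted tally met θ ≥ 0, the exempt one meets it. [folklore] -/
theorem exempt_miss_helps (θ : ℚ) (hθ : 0 ≤ θ) (t : Tally) (m : ℕ)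
    (h : meets θ (t.addMiss m) = true) : meets θ t = true := by
  induction m with
  | zero =>
    have h0 : t.addMiss 0 = t := by cases t; simp [addMiss]
    rw [h0] at h; exact h
  | succ m ih => exact ih (meets_addMiss_anti θ hθ t m h)

/-- THE v5 TABLE OF RECORD under the two readings (RUN #26 = maps/run-2026-08-27u; deputy-2 draft-4 regression = phasemap 1.8.14, two-engine 0):
v1.8 counting R = 10/14 (twins M180 D₃S, M181 LaD₁₀ counted, both AGREE); item 10 R = 8/12 (non-twins only). Both FAIL the 0.90 floor — the
ruling moves no clause today; 8/12 = the counted tally minus two agreeing twins. [folklore] -/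
theorem v5_run26_item10 :
    meets (9 / 10) (⟨8, 12⟩ : Tally) = false ∧ meets (9 / 10) ((⟨8, 12⟩ : Tally).addAgree 2) = false ∧
    (⟨8, 12⟩ : Tally).addAgree 2 = ⟨10, 14⟩ := by
  refine ⟨by norm_num [meets], by norm_num [meets, addAgree], by rfl⟩

/-- Where it WOULD matter (the margin case the rule exists for): a v5 table at 9/10 over non-twins meets 0.90; counting one non-agreeing twin
(9/11) fails it — and by item 10 the honest figure is the exempt one, PASS. Conversely 17/19 fails while counting one agreeing twin pair
member (18/20) would «pass» — item 10 keeps the honest FAIL (cf. `double_count_flips_pass`). [folklore] -/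
theorem item10_margin_cases :
    meets (9 / 10) (⟨9, 10⟩ : Tally) = true ∧ meets (9 / 10) ((⟨9, 10⟩ : Tally).addMiss 1) = false ∧
    meets (9 / 10) (⟨17, 19⟩ : Tally) = false ∧ meets (9 / 10) ((⟨17, 19⟩ : Tally).addAgree 1) = true := by
  refine ⟨by norm_num [meets], by norm_num [meets, addMiss], by norm_num [meets], by norm_num [meets, addAgree]⟩

end Tally

end CellScore

end Summit.Ventures.CertifiedManyBodySolver.Downfold
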